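import Literature.Probability.Percolation.LonelyClusterExchange
import HarnessLib

/-!
# `NoHeavyLowerTail` (stmt-CriticalPhenomena-4575) — hull-port line: marker-selection and three-cluster lemmas

Support file (prover `prim-hp-1`; `--supports stmt-CriticalPhenomena-4575`); no definitions, named facts or sorries; general finite
vertex type `V` (pure percolation inequalities, companions of `Literature.Probability.Percolation.LonelyClusterExchange`).
`R_v = {|π(v)| ≤ j}`; observers `x₁, x₂`, `U = C(x₁) ∪ C(x₂)`; markers `z, b`; SELECTED PIECE = the piece of `U` containing `z`
if `z ∈ U`, else the piece containing `b` if `b ∈ U`, else `U`; `Θ` = "the selected piece is light".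
`selection_pair_core`: `μ(R_{x₂}) ≤ μ(R_{x₁}) ⇒ μ(Θ) ≤ μ(R_{x₁})` (BHK Thm 1.5 = `twoClusterExchange` on `{x₁ ↮ x₂}` for the
selector "piece of `x₂`", which is closed under (shrinking `C_{x₁}`, enlarging `C_{x₂}`)); `threeCluster_marker`:
`μ(R_{x_i}) ≤ μ(R_z)` ⇒ `μ(z ∉ U, [b ∈ U ∧ R_b] ∨ [b ∉ U ∧ |π(U)| ≤ j]) ≤ μ(z ∉ U, R_z)` (crux memo HULLPORT-COUPLING.md §14).
[cite: VandenbergHaggstromKahn2005, Thm. 1.5 (p. 7) — corollaries via the tree's `twoClusterExchange`]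
-/

noncomputable section

namespace Summit.CriticalPhenomena.PercolationContinuityZ3.Theorems

open MeasureTheory Set Literature.Probability.LatticeModels Literature.Probability.Percolation
open scoped Classical

variable {V : Type*}

namespace HullPort

open LonelyClusterExchange TwoClusterExchange

/-- The selector "the piece of `x₂` is selected" — `z ↔ x₂`, or (`z ∉ U`, `b ↮ x₁`, `b ↔ x₂`) — is closed under
(shrinking `C_{x₁}`, enlarging `C_{x₂}`). [folklore] -/
theorem sel2_typeMinus (x₁ x₂ z b : V) ⦃ω ω' : BondConfig V⦄
    (hs : openEdgeCluster ω' x₁ ⊆ openEdgeCluster ω x₁) (ht : openEdgeCluster ω x₂ ⊆ openEdgeCluster ω' x₂)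
    (h : ω ∈ ((openConn x₂ z : Set (BondConfig V)) ∪
      ((openConn x₁ z)ᶜ ∩ (openConn x₂ z)ᶜ ∩ (openConn x₁ b)ᶜ ∩ openConn x₂ b))) :
    ω' ∈ ((openConn x₂ z : Set (BondConfig V)) ∪
      ((openConn x₁ z)ᶜ ∩ (openConn x₂ z)ᶜ ∩ (openConn x₁ b)ᶜ ∩ openConn x₂ b)) := by
  rcases h with h | ⟨⟨⟨h1, _⟩, h3⟩, h4⟩
  · exact Or.inl (typeMinus_openConn x₁ x₂ z hs ht h)
  · by_cases h' : ω' ∈ (openConn x₂ z : Set (BondConfig V))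
    · exact Or.inl h'
    · exact Or.inr ⟨⟨⟨typeMinus_not_openConn x₁ x₂ z hs ht h1, h'⟩,
        typeMinus_not_openConn x₁ x₂ b hs ht h3⟩, typeMinus_openConn x₁ x₂ b hs ht h4⟩

/-- **Marker-selection lemma (pair of observers), core.**  With `Θ` the event "the selected piece is light" (selection by
the markers `z`, then `b`, default `U`), if `μ(R_{x₂}) ≤ μ(R_{x₁})` then `μ(Θ) ≤ μ(R_{x₁})`.
[cite: VandenbergHaggstromKahn2005, Thm. 1.5 (p. 7) — corollary] -/
theorem selection_pair_core [Fintype V] (w : Sym2 V → unitInterval) (A : Finset V) (x₁ x₂ z b : V)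
    (hx : x₁ ≠ x₂) (j : ℕ)
    (hle : (prodBernoulli w).real {ω : BondConfig V | (A.filter fun t => ω ∈ openConn x₂ t).card ≤ j} ≤
      (prodBernoulli w).real {ω : BondConfig V | (A.filter fun t => ω ∈ openConn x₁ t).card ≤ j}) :
    (prodBernoulli w).real {ω : BondConfig V |
        ((ω ∈ openConn x₁ z ∨ ω ∈ openConn x₂ z) ∧ (A.filter fun t => ω ∈ openConn z t).card ≤ j) ∨
        (ω ∉ openConn x₁ z ∧ ω ∉ openConn x₂ z ∧ (ω ∈ openConn x₁ b ∨ ω ∈ openConn x₂ b) ∧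
          (A.filter fun t => ω ∈ openConn b t).card ≤ j) ∨
        (ω ∉ openConn x₁ z ∧ ω ∉ openConn x₂ z ∧ ω ∉ openConn x₁ b ∧ ω ∉ openConn x₂ b ∧
          (A.filter fun t => ω ∈ openConn x₁ t ∨ ω ∈ openConn x₂ t).card ≤ j)} ≤
      (prodBernoulli w).real {ω : BondConfig V | (A.filter fun t => ω ∈ openConn x₁ t).card ≤ j} := by
  set μ := prodBernoulli w with hμ
  have hmeas : ∀ S : Set (BondConfig V), MeasurableSet S := fun S => (Set.toFinite S).measurableSet
  set R1 : Set (BondConfig V) := {ω | (A.filter fun t => ω ∈ openConn x₁ t).card ≤ j} with hR1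
  set R2 : Set (BondConfig V) := {ω | (A.filter fun t => ω ∈ openConn x₂ t).card ≤ j} with hR2
  set Θ : Set (BondConfig V) := {ω : BondConfig V |
        ((ω ∈ openConn x₁ z ∨ ω ∈ openConn x₂ z) ∧ (A.filter fun t => ω ∈ openConn z t).card ≤ j) ∨
        (ω ∉ openConn x₁ z ∧ ω ∉ openConn x₂ z ∧ (ω ∈ openConn x₁ b ∨ ω ∈ openConn x₂ b) ∧
          (A.filter fun t => ω ∈ openConn b t).card ≤ j) ∨
        (ω ∉ openConn x₁ z ∧ ω ∉ openConn x₂ z ∧ ω ∉ openConn x₁ b ∧ ω ∉ openConn x₂ b ∧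
          (A.filter fun t => ω ∈ openConn x₁ t ∨ ω ∈ openConn x₂ t).card ≤ j)} with hΘ
  -- the partition by the selected piece
  set P1 : Set (BondConfig V) := openConn x₁ z ∪ ((openConn x₁ z)ᶜ ∩ (openConn x₂ z)ᶜ ∩ openConn x₁ b)
    with hP1
  set Sel2 : Set (BondConfig V) := openConn x₂ z ∪
    ((openConn x₁ z)ᶜ ∩ (openConn x₂ z)ᶜ ∩ (openConn x₁ b)ᶜ ∩ openConn x₂ b) with hSel2
  set D : Set (BondConfig V) := (openConn x₁ x₂)ᶜ with hD
  set P2 : Set (BondConfig V) := D ∩ Sel2 with hP2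
  set P0 : Set (BondConfig V) :=
    (openConn x₁ z)ᶜ ∩ (openConn x₂ z)ᶜ ∩ (openConn x₁ b)ᶜ ∩ (openConn x₂ b)ᶜ with hP0
  -- relay filters agree along a connection
  have filter_eq : ∀ (ω : BondConfig V) (u v : V), (openGraph ω).Reachable u v →
      (A.filter fun t => ω ∈ openConn v t) = (A.filter fun t => ω ∈ openConn u t) := by
    intro ω u v huv
    exact Finset.filter_congr fun t _ =>
      ⟨fun ht => (huv.trans ht : (openGraph ω).Reachable u t),
        fun ht => (huv.symm.trans ht : (openGraph ω).Reachable v t)⟩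
  -- (a) Θ ∩ P1 ⊆ R1
  have hΘ1 : Θ ∩ P1 ⊆ R1 ∩ P1 := by
    rintro ω ⟨hθ, hp⟩
    refine ⟨?_, hp⟩
    simp only [hΘ, mem_setOf_eq] at hθ
    simp only [hR1, mem_setOf_eq]
    rcases hp with hz1 | ⟨⟨hz1, hz2⟩, hb1⟩
    · have hz1' : (openGraph ω).Reachable x₁ z := hz1
      rcases hθ with ⟨-, hRz⟩ | ⟨hnz1, -⟩ | ⟨hnz1, -⟩
      · rw [filter_eq ω x₁ z hz1'] at hRz; exact hRz
      · exact absurd hz1 hnz1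
      · exact absurd hz1 hnz1
    · have hb1' : (openGraph ω).Reachable x₁ b := hb1
      rcases hθ with ⟨hzU, -⟩ | ⟨-, -, -, hRb⟩ | ⟨-, -, hnb1, -⟩
      · rcases hzU with h | h
        · exact absurd h hz1
        · exact absurd h hz2
      · rw [filter_eq ω x₁ b hb1'] at hRb; exact hRb
      · exact absurd hb1 hnb1
  -- (b) Θ ∩ P0 ⊆ R1
  have hΘ0 : Θ ∩ P0 ⊆ R1 ∩ P0 := by
    rintro ω ⟨hθ, hp⟩
    refine ⟨?_, hp⟩
    obtain ⟨⟨⟨hz1, hz2⟩, hb1⟩, hb2⟩ := hp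
    simp only [hΘ, mem_setOf_eq] at hθ
    simp only [hR1, mem_setOf_eq]
    rcases hθ with ⟨hzU, -⟩ | ⟨-, -, hbU, -⟩ | ⟨-, -, -, -, hU⟩
    · rcases hzU with h | h
      · exact absurd h hz1
      · exact absurd h hz2
    · rcases hbU with h | h
      · exact absurd h hb1
      · exact absurd h hb2
    · refine le_trans (Finset.card_le_card ?_) hU
      intro t ht
      rw [Finset.mem_filter] at ht ⊢
      exact ⟨ht.1, Or.inl ht.2⟩
  -- (c) Θ ∩ P2 ⊆ P2 ∩ R2
  have hΘ2 : Θ ∩ P2 ⊆ P2 ∩ R2 := by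
    rintro ω ⟨hθ, hp⟩
    refine ⟨hp, ?_⟩
    obtain ⟨hDω, hsel⟩ := hp
    simp only [hΘ, mem_setOf_eq] at hθ
    simp only [hR2, mem_setOf_eq]
    rcases hsel with hz2 | ⟨⟨⟨hz1, hz2⟩, hb1⟩, hb2⟩
    · have hz2' : (openGraph ω).Reachable x₂ z := hz2
      have hz1 : ω ∉ (openConn x₁ z : Set (BondConfig V)) := by
        intro h
        have h' : (openGraph ω).Reachable x₁ z := h
        exact hDω (h'.trans hz2'.symm)
      rcases hθ with ⟨-, hRz⟩ | ⟨-, hnz2, -⟩ | ⟨-, hnz2, -⟩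
      · rw [filter_eq ω x₂ z hz2'] at hRz; exact hRz
      · exact absurd hz2 hnz2
      · exact absurd hz2 hnz2
    · have hb2' : (openGraph ω).Reachable x₂ b := hb2
      rcases hθ with ⟨hzU, -⟩ | ⟨-, -, -, hRb⟩ | ⟨-, -, -, hnb2, -⟩
      · rcases hzU with h | h
        · exact absurd h hz1
        · exact absurd h hz2
      · rw [filter_eq ω x₂ b hb2'] at hRb; exact hRb
      · exact absurd hb2 hnb2
  -- (d) the three selectors cover everything and are pairwise disjoint
  have hcover : ∀ ω : BondConfig V, ω ∈ P1 ∨ ω ∈ P2 ∨ ω ∈ P0 := by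
    intro ω
    by_cases hz1 : ω ∈ (openConn x₁ z : Set (BondConfig V))
    · exact Or.inl (Or.inl hz1)
    by_cases hz2 : ω ∈ (openConn x₂ z : Set (BondConfig V))
    · refine Or.inr (Or.inl ⟨?_, Or.inl hz2⟩)
      intro h12
      have h12' : (openGraph ω).Reachable x₁ x₂ := h12
      have hz2' : (openGraph ω).Reachable x₂ z := hz2
      exact hz1 (h12'.trans hz2')
    by_cases hb1 : ω ∈ (openConn x₁ b : Set (BondConfig V))
    · exact Or.inl (Or.inr ⟨⟨hz1, hz2⟩, hb1⟩)
    by_cases hb2 : ω ∈ (openConn x₂ b : Set (BondConfig V))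
    · refine Or.inr (Or.inl ⟨?_, Or.inr ⟨⟨⟨hz1, hz2⟩, hb1⟩, hb2⟩⟩)
      intro h12
      have h12' : (openGraph ω).Reachable x₁ x₂ := h12
      have hb2' : (openGraph ω).Reachable x₂ b := hb2
      exact hb1 (h12'.trans hb2')
    · exact Or.inr (Or.inr ⟨⟨⟨hz1, hz2⟩, hb1⟩, hb2⟩)
  have hd12 : Disjoint (R1 ∩ P1) (R1 ∩ P2) := by
    rw [Set.disjoint_left]
    rintro ω ⟨-, hp1⟩ ⟨-, ⟨hDω, hsel⟩⟩
    rcases hp1 with hz1 | ⟨⟨hz1, hz2⟩, hb1⟩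
    · have hz1' : (openGraph ω).Reachable x₁ z := hz1
      rcases hsel with hz2 | ⟨⟨⟨hnz1, -⟩, -⟩, -⟩
      · have hz2' : (openGraph ω).Reachable x₂ z := hz2
        exact hDω (hz1'.trans hz2'.symm)
      · exact hnz1 hz1
    · rcases hsel with hz2' | ⟨⟨⟨-, -⟩, hnb1⟩, -⟩
      · exact hz2 hz2'
      · exact hnb1 hb1
  have hd10 : Disjoint (R1 ∩ P1) (R1 ∩ P0) := by
    rw [Set.disjoint_left]
    rintro ω ⟨-, hp1⟩ ⟨-, ⟨⟨⟨hz1, hz2⟩, hb1⟩, hb2⟩⟩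
    rcases hp1 with h | ⟨-, h⟩
    · exact hz1 h
    · exact hb1 h
  have hd20 : Disjoint (R1 ∩ P2) (R1 ∩ P0) := by
    rw [Set.disjoint_left]
    rintro ω ⟨-, ⟨-, hsel⟩⟩ ⟨-, ⟨⟨⟨hz1, hz2⟩, hb1⟩, hb2⟩⟩
    rcases hsel with h | ⟨-, h⟩
    · exact hz2 h
    · exact hb2 h
  -- (e) μ(Θ) ≤ μ(R1 ∩ P1) + μ(P2 ∩ R2) + μ(R1 ∩ P0)
  have hΘsplit : Θ ⊆ (Θ ∩ P1) ∪ (Θ ∩ P2) ∪ (Θ ∩ P0) := by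
    intro ω hω
    rcases hcover ω with h | h | h
    · exact Or.inl (Or.inl ⟨hω, h⟩)
    · exact Or.inl (Or.inr ⟨hω, h⟩)
    · exact Or.inr ⟨hω, h⟩
  have hΘle : μ.real Θ ≤ μ.real (R1 ∩ P1) + μ.real (P2 ∩ R2) + μ.real (R1 ∩ P0) := by
    calc μ.real Θ ≤ μ.real ((Θ ∩ P1) ∪ (Θ ∩ P2) ∪ (Θ ∩ P0)) := measureReal_mono hΘsplit (measure_ne_top _ _)
      _ ≤ μ.real ((Θ ∩ P1) ∪ (Θ ∩ P2)) + μ.real (Θ ∩ P0) := measureReal_union_le _ _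
      _ ≤ μ.real (Θ ∩ P1) + μ.real (Θ ∩ P2) + μ.real (Θ ∩ P0) := by
          linarith [measureReal_union_le (μ := μ) (Θ ∩ P1) (Θ ∩ P2)]
      _ ≤ μ.real (R1 ∩ P1) + μ.real (P2 ∩ R2) + μ.real (R1 ∩ P0) := by
          linarith [measureReal_mono (μ := μ) hΘ1 (measure_ne_top _ _),
            measureReal_mono (μ := μ) hΘ2 (measure_ne_top _ _),
            measureReal_mono (μ := μ) hΘ0 (measure_ne_top _ _)]
  -- (f) μ(R1) ≥ μ(R1 ∩ P1) + μ(R1 ∩ P2) + μ(R1 ∩ P0)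
  have hR1ge : μ.real (R1 ∩ P1) + μ.real (R1 ∩ P2) + μ.real (R1 ∩ P0) ≤ μ.real R1 := by
    have hu1 : μ.real ((R1 ∩ P1) ∪ (R1 ∩ P2)) = μ.real (R1 ∩ P1) + μ.real (R1 ∩ P2) :=
      measureReal_union hd12 (hmeas _)
    have hd : Disjoint ((R1 ∩ P1) ∪ (R1 ∩ P2)) (R1 ∩ P0) := Disjoint.union_left hd10 hd20
    have hu2 : μ.real (((R1 ∩ P1) ∪ (R1 ∩ P2)) ∪ (R1 ∩ P0)) =
        μ.real ((R1 ∩ P1) ∪ (R1 ∩ P2)) + μ.real (R1 ∩ P0) := measureReal_union hd (hmeas _)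
    have hsub : ((R1 ∩ P1) ∪ (R1 ∩ P2)) ∪ (R1 ∩ P0) ⊆ R1 := by
      rintro ω ((⟨h, -⟩ | ⟨h, -⟩) | ⟨h, -⟩) <;> exact h
    have := measureReal_mono (μ := μ) hsub (measure_ne_top _ _)
    linarith
  -- (g) KEY (BHK): μ(P2 ∩ R2) ≤ μ(P2 ∩ R1)
  have hkey : μ.real (P2 ∩ R2) ≤ μ.real (P2 ∩ R1) := by
    set Gp : Set (BondConfig V) := R2 ∩ R1ᶜ with hGp
    set Gm : Set (BondConfig V) := R1 ∩ R2ᶜ with hGm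
    -- types
    have hGp_t : ∀ ⦃ω ω' : BondConfig V⦄, openEdgeCluster ω x₁ ⊆ openEdgeCluster ω' x₁ →
        openEdgeCluster ω' x₂ ⊆ openEdgeCluster ω x₂ → ω ∈ Gp → ω' ∈ Gp := by
      intro ω ω' hs ht hω
      refine ⟨typePlus_card_le A j x₁ x₂ hs ht hω.1, ?_⟩
      intro h'
      exact hω.2 (typeMinus_card_le A j x₁ x₂ hs ht h')
    have hGm_t : ∀ ⦃ω ω' : BondConfig V⦄, openEdgeCluster ω' x₁ ⊆ openEdgeCluster ω x₁ →
        openEdgeCluster ω x₂ ⊆ openEdgeCluster ω' x₂ → ω ∈ Gm → ω' ∈ Gm := by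
      intro ω ω' hs ht hω
      refine ⟨typeMinus_card_le A j x₁ x₂ hs ht hω.1, ?_⟩
      intro h'
      exact hω.2 (typePlus_card_le A j x₁ x₂ hs ht h')
    have hSel_t : ∀ ⦃ω ω' : BondConfig V⦄, openEdgeCluster ω' x₁ ⊆ openEdgeCluster ω x₁ →
        openEdgeCluster ω x₂ ⊆ openEdgeCluster ω' x₂ → ω ∈ Sel2 → ω' ∈ Sel2 :=
      fun ω ω' hs ht hω => sel2_typeMinus x₁ x₂ z b hs ht hω
    have huniv_p : ∀ ⦃ω ω' : BondConfig V⦄, openEdgeCluster ω x₁ ⊆ openEdgeCluster ω' x₁ →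
        openEdgeCluster ω' x₂ ⊆ openEdgeCluster ω x₂ → ω ∈ (univ : Set (BondConfig V)) → ω' ∈ (univ : Set _) :=
      fun _ _ _ _ _ => mem_univ _
    have huniv_m : ∀ ⦃ω ω' : BondConfig V⦄, openEdgeCluster ω' x₁ ⊆ openEdgeCluster ω x₁ →
        openEdgeCluster ω x₂ ⊆ openEdgeCluster ω' x₂ → ω ∈ (univ : Set (BondConfig V)) → ω' ∈ (univ : Set _) :=
      fun _ _ _ _ _ => mem_univ _
    -- exchange (i): μ(D ∩ (Gp ∩ Sel2)) μ(D) ≤ μ(D ∩ Gp) μ(D ∩ Sel2)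
    have ex1 := twoClusterExchange w hx (A₁ := Gp) (A₂ := univ) (B₁ := Sel2) (B₂ := univ)
      hGp_t huniv_p hSel_t huniv_m
    -- exchange (ii): μ(D ∩ Sel2) μ(D ∩ Gm) ≤ μ(D) μ(D ∩ (Sel2 ∩ Gm))
    have ex2 := twoClusterExchange w hx (A₁ := univ) (A₂ := univ) (B₁ := Sel2) (B₂ := Gm)
      huniv_p huniv_p hSel_t hGm_t
    simp only [inter_univ, univ_inter] at ex1 ex2
    change μ.real (D ∩ (Gp ∩ Sel2)) * μ.real D ≤ μ.real (D ∩ Gp) * μ.real (D ∩ Sel2) at ex1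
    change μ.real (D ∩ Sel2) * μ.real (D ∩ Gm) ≤ μ.real D * μ.real (D ∩ (Sel2 ∩ Gm)) at ex2
    -- μ(D ∩ Gp) ≤ μ(D ∩ Gm): the loneliness events coincide on `{x₁ ↔ x₂}`
    have hDc : R2 \ D = R1 \ D := by
      ext ω
      simp only [hR1, hR2, hD, mem_sdiff, mem_compl_iff, not_not, mem_setOf_eq]
      constructor
      · rintro ⟨h, h12⟩
        have h12' : (openGraph ω).Reachable x₁ x₂ := h12
        rw [filter_eq ω x₁ x₂ h12'] at h; exact ⟨h, h12⟩
      · rintro ⟨h, h12⟩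
        have h12' : (openGraph ω).Reachable x₁ x₂ := h12
        rw [filter_eq ω x₁ x₂ h12']; exact ⟨h, h12⟩
    have s1 : μ.real (R1 ∩ D) + μ.real (R1 \ D) = μ.real R1 := measureReal_inter_add_sdiff (hmeas D)
    have s2 : μ.real (R2 ∩ D) + μ.real (R2 \ D) = μ.real R2 := measureReal_inter_add_sdiff (hmeas D)
    have hD12 : μ.real (R2 ∩ D) ≤ μ.real (R1 ∩ D) := by rw [hDc] at s2; linarith
    have t1 : μ.real (R1 ∩ D ∩ R2) + μ.real ((R1 ∩ D) \ R2) = μ.real (R1 ∩ D) :=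
      measureReal_inter_add_sdiff (hmeas R2)
    have t2 : μ.real (R2 ∩ D ∩ R1) + μ.real ((R2 ∩ D) \ R1) = μ.real (R2 ∩ D) :=
      measureReal_inter_add_sdiff (hmeas R1)
    have e1 : R1 ∩ D ∩ R2 = R2 ∩ D ∩ R1 := by ext ω; simp only [mem_inter_iff]; tauto
    have e2 : (R1 ∩ D) \ R2 = D ∩ Gm := by
      ext ω; simp only [hGm, mem_sdiff, mem_inter_iff, mem_compl_iff]; tauto
    have e3 : (R2 ∩ D) \ R1 = D ∩ Gp := by
      ext ω; simp only [hGp, mem_sdiff, mem_inter_iff, mem_compl_iff]; tauto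
    rw [e1, e2] at t1
    rw [e3] at t2
    have hG : μ.real (D ∩ Gp) ≤ μ.real (D ∩ Gm) := by linarith
    -- μ(P2 ∩ Gp) ≤ μ(P2 ∩ Gm)
    have hPG : μ.real (D ∩ (Gp ∩ Sel2)) ≤ μ.real (D ∩ (Sel2 ∩ Gm)) := by
      by_cases hD0 : μ.real D = 0
      · have : μ.real (D ∩ (Gp ∩ Sel2)) ≤ μ.real D := measureReal_mono inter_subset_left (measure_ne_top _ _)
        linarith [measureReal_nonneg (μ := μ) (s := D ∩ (Sel2 ∩ Gm))]
      · have hDpos : 0 < μ.real D := lt_of_le_of_ne measureReal_nonneg (Ne.symm hD0)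
        have h3 : μ.real (D ∩ Gp) * μ.real (D ∩ Sel2) ≤ μ.real (D ∩ Gm) * μ.real (D ∩ Sel2) :=
          mul_le_mul_of_nonneg_right hG measureReal_nonneg
        have h4 : μ.real (D ∩ (Gp ∩ Sel2)) * μ.real D ≤ μ.real D * μ.real (D ∩ (Sel2 ∩ Gm)) := by
          calc μ.real (D ∩ (Gp ∩ Sel2)) * μ.real D ≤ μ.real (D ∩ Gp) * μ.real (D ∩ Sel2) := ex1
            _ ≤ μ.real (D ∩ Gm) * μ.real (D ∩ Sel2) := h3
            _ = μ.real (D ∩ Sel2) * μ.real (D ∩ Gm) := mul_comm _ _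
            _ ≤ μ.real D * μ.real (D ∩ (Sel2 ∩ Gm)) := ex2
        rw [mul_comm (μ.real D)] at h4
        exact le_of_mul_le_mul_right h4 hDpos
    -- rewrite P2 ∩ R2 and P2 ∩ R1
    have u1 : μ.real (P2 ∩ R2 ∩ R1) + μ.real ((P2 ∩ R2) \ R1) = μ.real (P2 ∩ R2) :=
      measureReal_inter_add_sdiff (hmeas R1)
    have u2 : μ.real (P2 ∩ R1 ∩ R2) + μ.real ((P2 ∩ R1) \ R2) = μ.real (P2 ∩ R1) :=
      measureReal_inter_add_sdiff (hmeas R2)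
    have e4 : P2 ∩ R2 ∩ R1 = P2 ∩ R1 ∩ R2 := by ext ω; simp only [mem_inter_iff]; tauto
    have e5 : (P2 ∩ R2) \ R1 = D ∩ (Gp ∩ Sel2) := by
      ext ω; simp only [hP2, hGp, mem_sdiff, mem_inter_iff, mem_compl_iff]; tauto
    have e6 : (P2 ∩ R1) \ R2 = D ∩ (Sel2 ∩ Gm) := by
      ext ω; simp only [hP2, hGm, mem_sdiff, mem_inter_iff, mem_compl_iff]; tauto
    rw [e4, e5] at u1
    rw [e6] at u2
    linarith
  have e7 : R1 ∩ P2 = P2 ∩ R1 := inter_comm _ _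
  rw [e7] at hR1ge
  linarith

/-- **Three-cluster lemma**: for observers `x₁ ≠ x₂` and vertices `z, b` with `μ(R_{x_i}) ≤ μ(R_z)` (`i = 1, 2`),
`μ(z ∉ U, [b ∈ U ∧ R_b] ∨ [b ∉ U ∧ |π(U)| ≤ j]) ≤ μ(z ∉ U, R_z)` (`selection_pair_core` minus the common part
`{z ∈ U} ∩ R_z`). [cite: VandenbergHaggstromKahn2005, Thm. 1.5 (p. 7) — corollary] -/
theorem threeCluster_marker [Fintype V] (w : Sym2 V → unitInterval) (A : Finset V) (x₁ x₂ z b : V)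
    (hx : x₁ ≠ x₂) (j : ℕ)
    (h1 : (prodBernoulli w).real {ω : BondConfig V | (A.filter fun t => ω ∈ openConn x₁ t).card ≤ j} ≤
      (prodBernoulli w).real {ω : BondConfig V | (A.filter fun t => ω ∈ openConn z t).card ≤ j})
    (h2 : (prodBernoulli w).real {ω : BondConfig V | (A.filter fun t => ω ∈ openConn x₂ t).card ≤ j} ≤
      (prodBernoulli w).real {ω : BondConfig V | (A.filter fun t => ω ∈ openConn z t).card ≤ j}) :
    (prodBernoulli w).real {ω : BondConfig V | ω ∉ openConn x₁ z ∧ ω ∉ openConn x₂ z ∧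
        (((ω ∈ openConn x₁ b ∨ ω ∈ openConn x₂ b) ∧ (A.filter fun t => ω ∈ openConn b t).card ≤ j) ∨
          (ω ∉ openConn x₁ b ∧ ω ∉ openConn x₂ b ∧
            (A.filter fun t => ω ∈ openConn x₁ t ∨ ω ∈ openConn x₂ t).card ≤ j))} ≤
      (prodBernoulli w).real {ω : BondConfig V | ω ∉ openConn x₁ z ∧ ω ∉ openConn x₂ z ∧
        (A.filter fun t => ω ∈ openConn z t).card ≤ j} := by
  set μ := prodBernoulli w with hμ
  have hmeas : ∀ S : Set (BondConfig V), MeasurableSet S := fun S => (Set.toFinite S).measurableSet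
  set Rz : Set (BondConfig V) := {ω | (A.filter fun t => ω ∈ openConn z t).card ≤ j} with hRz
  set Θ : Set (BondConfig V) := {ω : BondConfig V |
        ((ω ∈ openConn x₁ z ∨ ω ∈ openConn x₂ z) ∧ (A.filter fun t => ω ∈ openConn z t).card ≤ j) ∨
        (ω ∉ openConn x₁ z ∧ ω ∉ openConn x₂ z ∧ (ω ∈ openConn x₁ b ∨ ω ∈ openConn x₂ b) ∧
          (A.filter fun t => ω ∈ openConn b t).card ≤ j) ∨
        (ω ∉ openConn x₁ z ∧ ω ∉ openConn x₂ z ∧ ω ∉ openConn x₁ b ∧ ω ∉ openConn x₂ b ∧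
          (A.filter fun t => ω ∈ openConn x₁ t ∨ ω ∈ openConn x₂ t).card ≤ j)} with hΘ
  have hΘz : μ.real Θ ≤ μ.real Rz := by
    by_cases hle : μ.real {ω : BondConfig V | (A.filter fun t => ω ∈ openConn x₂ t).card ≤ j} ≤
        μ.real {ω : BondConfig V | (A.filter fun t => ω ∈ openConn x₁ t).card ≤ j}
    · exact (selection_pair_core w A x₁ x₂ z b hx j hle).trans h1
    · have hle' : μ.real {ω : BondConfig V | (A.filter fun t => ω ∈ openConn x₁ t).card ≤ j} ≤
          μ.real {ω : BondConfig V | (A.filter fun t => ω ∈ openConn x₂ t).card ≤ j} := (lt_of_not_ge hle).le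
      have core := selection_pair_core w A x₂ x₁ z b hx.symm j hle'
      have hfilt : ∀ ω : BondConfig V, (A.filter fun t => ω ∈ openConn x₂ t ∨ ω ∈ openConn x₁ t) =
          (A.filter fun t => ω ∈ openConn x₁ t ∨ ω ∈ openConn x₂ t) :=
        fun ω => Finset.filter_congr fun t _ => or_comm
      have hsub : Θ ⊆ {ω : BondConfig V |
          ((ω ∈ openConn x₂ z ∨ ω ∈ openConn x₁ z) ∧ (A.filter fun t => ω ∈ openConn z t).card ≤ j) ∨
          (ω ∉ openConn x₂ z ∧ ω ∉ openConn x₁ z ∧ (ω ∈ openConn x₂ b ∨ ω ∈ openConn x₁ b) ∧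
            (A.filter fun t => ω ∈ openConn b t).card ≤ j) ∨
          (ω ∉ openConn x₂ z ∧ ω ∉ openConn x₁ z ∧ ω ∉ openConn x₂ b ∧ ω ∉ openConn x₁ b ∧
            (A.filter fun t => ω ∈ openConn x₂ t ∨ ω ∈ openConn x₁ t).card ≤ j)} := by
        intro ω hω
        simp only [hΘ, mem_setOf_eq] at hω
        simp only [mem_setOf_eq, hfilt]
        rcases hω with ⟨hzU, hRz'⟩ | ⟨hz1, hz2, hbU, hRb⟩ | ⟨hz1, hz2, hb1, hb2, hU⟩
        · exact Or.inl ⟨hzU.symm, hRz'⟩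
        · exact Or.inr (Or.inl ⟨hz2, hz1, hbU.symm, hRb⟩)
        · exact Or.inr (Or.inr ⟨hz2, hz1, hb2, hb1, hU⟩)
      exact ((measureReal_mono hsub (measure_ne_top _ _)).trans core).trans h2
  set Zin : Set (BondConfig V) := openConn x₁ z ∪ openConn x₂ z with hZin
  set L : Set (BondConfig V) := {ω : BondConfig V | ω ∉ openConn x₁ z ∧ ω ∉ openConn x₂ z ∧
        (((ω ∈ openConn x₁ b ∨ ω ∈ openConn x₂ b) ∧ (A.filter fun t => ω ∈ openConn b t).card ≤ j) ∨
          (ω ∉ openConn x₁ b ∧ ω ∉ openConn x₂ b ∧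
            (A.filter fun t => ω ∈ openConn x₁ t ∨ ω ∈ openConn x₂ t).card ≤ j))} with hL
  have eΘ2 : Θ = (Zin ∩ Rz) ∪ L := by
    ext ω
    simp only [hΘ, hZin, hRz, hL, mem_setOf_eq, mem_union, mem_inter_iff]
    refine ⟨?_, ?_⟩
    · rintro (⟨hzU, hRz'⟩ | ⟨hz1, hz2, hbU, hRb⟩ | ⟨hz1, hz2, hb1, hb2, hU⟩)
      exacts [Or.inl ⟨hzU, hRz'⟩, Or.inr ⟨hz1, hz2, Or.inl ⟨hbU, hRb⟩⟩, Or.inr ⟨hz1, hz2, Or.inr ⟨hb1, hb2, hU⟩⟩]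
    · rintro (⟨hzU, hRz'⟩ | ⟨hz1, hz2, (⟨hbU, hRb⟩ | ⟨hb1, hb2, hU⟩)⟩)
      exacts [Or.inl ⟨hzU, hRz'⟩, Or.inr (Or.inl ⟨hz1, hz2, hbU, hRb⟩), Or.inr (Or.inr ⟨hz1, hz2, hb1, hb2, hU⟩)]
  have hdisj : Disjoint (Zin ∩ Rz) L := by
    rw [Set.disjoint_left]; rintro ω ⟨(h | h), -⟩ ⟨h1', h2', -⟩; exacts [h1' h, h2' h]
  have eR : Rz = (Zin ∩ Rz) ∪ {ω : BondConfig V | ω ∉ openConn x₁ z ∧ ω ∉ openConn x₂ z ∧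
        (A.filter fun t => ω ∈ openConn z t).card ≤ j} := by
    ext ω
    simp only [hZin, hRz, mem_setOf_eq, mem_union, mem_inter_iff]
    refine ⟨fun hRz' => ?_, fun h => h.elim (fun h => h.2) (fun h => h.2.2)⟩
    by_cases hz1 : ω ∈ (openConn x₁ z : Set (BondConfig V))
    · exact Or.inl ⟨Or.inl hz1, hRz'⟩
    by_cases hz2 : ω ∈ (openConn x₂ z : Set (BondConfig V))
    · exact Or.inl ⟨Or.inr hz2, hRz'⟩
    · exact Or.inr ⟨hz1, hz2, hRz'⟩
  have hdisjR : Disjoint (Zin ∩ Rz) {ω : BondConfig V | ω ∉ openConn x₁ z ∧ ω ∉ openConn x₂ z ∧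
        (A.filter fun t => ω ∈ openConn z t).card ≤ j} := by
    rw [Set.disjoint_left]; rintro ω ⟨(h | h), -⟩ ⟨h1', h2', -⟩; exacts [h1' h, h2' h]
  have m1 : μ.real Θ = μ.real (Zin ∩ Rz) + μ.real L := by rw [eΘ2, measureReal_union hdisj (hmeas _)]
  have m2 : μ.real Rz = μ.real (Zin ∩ Rz) + μ.real {ω : BondConfig V | ω ∉ openConn x₁ z ∧
      ω ∉ openConn x₂ z ∧ (A.filter fun t => ω ∈ openConn z t).card ≤ j} := by
    conv_lhs => rw [eR]
    rw [measureReal_union hdisjR (hmeas _)]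
  change μ.real L ≤ _
  linarith

end HullPort

end Summit.CriticalPhenomena.PercolationContinuityZ3.Theorems

end
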